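import Mathlib

/-!
# Elements of order prime to `|G¹|` in `G = G¹ · G″` lie in `G″`
  (Theorem N5.T3: «its image lies in `G″` (orders prime to `q_w`)»)

Theorem N5.T3 of `route/TIER5.md` §N5.11.6 decomposes the finite abelian group
`G := E¹_w/(E¹_w ∩ U²)` of order `(q_w + 1) q_w` as `G = G¹ × G″` with `|G¹| = q_w`,
`|G″| = q_w + 1` (coprime orders, (A3c)), and notes that the image of `μ(E)` — whose elements
have order prime to `p_w`, hence to `q_w` — «lies in `G″` (orders prime to `q_w`)». This file
checks the one-line group theory behind the note, for any abelian group `G` with subgroups `A`,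
`B` of coprime finite orders:

* `mem_right_of_coprime_orderOf`: an element `x = a · b` (`a ∈ A`, `b ∈ B`) whose order is prime
  to `|A|` lies in `B` — the `A`-component `a = x · b⁻¹` has order dividing both `|A|` and
  `lcm(ord x, |B|)`, which are coprime, so `a = 1`;
* `mem_right_of_coprime_orderOf_of_sup_eq_top`: the same for every `x ∈ G` when `A ⊔ B = G`.

Declaration per README §8(d): «uses an L-value-free non-vanishing device: NO».
-/

namespace Summit.Ventures.HodgeRepro2.T5CoprimeOrderMember

variable {G : Type*} [CommGroup G]

/-- In an abelian group with subgroups `A`, `B` of coprime finite orders, an element of `A ⊔ B`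
whose order is prime to `|A|` lies in `B`. -/
theorem mem_right_of_coprime_orderOf (A B : Subgroup G) [Finite A] [Finite B]
    (hAB : Nat.Coprime (Nat.card A) (Nat.card B)) {x : G} (hx : x ∈ A ⊔ B)
    (hcop : Nat.Coprime (orderOf x) (Nat.card A)) : x ∈ B := by
  obtain ⟨a, ha, b, hb, rfl⟩ := Subgroup.mem_sup.1 hx
  -- the `A`-component `a` has order dividing `|A|` …
  have hA : orderOf a ∣ Nat.card A := by
    have := orderOf_dvd_natCard (⟨a, ha⟩ : A)
    rwa [← Subgroup.orderOf_coe] at this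
  -- … and dividing `lcm (ord (a b)) (ord b)`, hence `ord (a b) * |B|`
  have hB : orderOf b ∣ Nat.card B := by
    have := orderOf_dvd_natCard (⟨b, hb⟩ : B)
    rwa [← Subgroup.orderOf_coe] at this
  have h2 : orderOf a ∣ orderOf (a * b) * Nat.card B := by
    have e : a = a * b * b⁻¹ := by group
    have h := (Commute.all (a * b) b⁻¹).orderOf_mul_dvd_lcm
    rw [← e, orderOf_inv] at h
    exact h.trans ((Nat.lcm_dvd_mul _ _).trans (Nat.mul_dvd_mul_left _ hB))
  -- coprimality forces `ord a = 1`
  have hcop' : Nat.Coprime (Nat.card A) (orderOf (a * b) * Nat.card B) :=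
    Nat.Coprime.mul_right hcop.symm hAB
  have h1 : orderOf a = 1 := Nat.eq_one_of_dvd_coprimes hcop' hA h2
  rw [orderOf_eq_one_iff] at h1
  rw [h1, one_mul]
  exact hb

/-- With `A ⊔ B = G`: every element of order prime to `|A|` lies in `B`. -/
theorem mem_right_of_coprime_orderOf_of_sup_eq_top (A B : Subgroup G) [Finite A] [Finite B]
    (hAB : Nat.Coprime (Nat.card A) (Nat.card B)) (htop : A ⊔ B = ⊤) {x : G}
    (hcop : Nat.Coprime (orderOf x) (Nat.card A)) : x ∈ B :=
  mem_right_of_coprime_orderOf A B hAB (htop ▸ Subgroup.mem_top x) hcop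

/-- The form used in Theorem N5.T3: if `|A| = q` and the order of `x` is prime to `q`, then
`x ∈ B` (the subgroup of order `q + 1`, coprime to `q`). -/
theorem mem_right_of_coprime_orderOf_of_card (A B : Subgroup G) [Finite A] [Finite B]
    (htop : A ⊔ B = ⊤) {q : ℕ} (hA : Nat.card A = q) (hB : Nat.card B = q + 1) {x : G}
    (hcop : Nat.Coprime (orderOf x) q) : x ∈ B := by
  refine mem_right_of_coprime_orderOf_of_sup_eq_top A B ?_ htop (by rwa [hA])
  rw [hA, hB]
  exact Nat.coprime_self_add_right.2 (Nat.coprime_one_right q)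

end Summit.Ventures.HodgeRepro2.T5CoprimeOrderMember
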